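/-
Cell pub-hodgecm2 (COR-CM = stage 2 of the Hodge ladder), seat p2 (binder prover 2/8), gen 22
(prover-pub-hodgecm2-p2-g22-0), 2026-08-21.  Count-neutral own lane PERL-WEIL-LINE: the GLUE of work items W-a (p2,
`CorCM/PerLWeilLineClasses.lean` + `CorCM/PerLWeilLineClassesAnyRealisation.lean`) and W-b (b25, `CorCM/PairFlipSexticFourCoreTransfer.lean`) of
`hodge-director/B01-SIZE.md` §4 T2.  Theorems only; `PerL` is consumed BY NAME (`Universe.PerL`), never restated.
T5: the only hypothesis binders of Literature/conjecture type are `hP : U_rec.PerL` (resp. the four universe records,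
all tree theorems, + `hP`) — joint inhabitation = PerL(U_rec), the cell's standing hypothesis; no contradiction derived.
HONEST FRAMING: HC_CM is NOT proved.  What IS proved: IF stage 1's statement `PerL` holds on the model universe of
record THEN the Hodge conjecture holds for every abelian variety dominated by a product of powers of the four CM
threefolds of a pair-flip sextic CM field (frame form).  This is a NAMED CLASS, conditional on `PerL`; not HC_CM.
(W-a record files: `CorCM/PerLWeilLineClasses.lean` p289327 ✔, `CorCM/PerLWeilLineClassesAnyRealisation.lean`.)
-/
import Summits.HodgeConjecture.CorCM.PerLWeilLineClassesAnyRealisation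
import Summits.HodgeConjecture.CorCM.PerLTypesOfFourTypes
import Summits.HodgeConjecture.CorCM.PairFlipSexticFourCoreTransfer
import HarnessLib

/-!
# `PerL` ⟹ the Hodge conjecture for every product of powers of the four CM threefolds of a pair-flip sextic
# CM field (frame form) — W-a glued to W-b

Seat b25's transfer theorem `PairFlipSexticFourCore.hodgeConjectureFor_biproduct_comp_of_faces` proves
`HodgeConjectureFor (⨁_j A₄ (κ j))` — every product of powers `X₀^a × X₁^b × X₂^c × X₃^d` of four CM abelian threefolds
`A₄ b ⊨ (K; Φ₄ b)` of a sextic CM field `K` read in a FRAME `e : Hom(K, ℂ) ≃ ℤ/3 × Bool` (`he_conj`, `he_gal`: the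
pair-flip / closure 24–48 situation; types `(+,+,+), (−,+,+), (+,−,+), (+,+,−)` via the model type `phi`) — from the
frame data and ONE hypothesis `hface`: the weight lines of the six face weights
`{(0,i,s), (1,i,¬s), (2,i,¬s), (3,i,¬s)}` of `Y = X₀ × X₁ × X₂ × X₃` are algebraic.

THIS FILE discharges `hface` from `PerL` (W-a, `CorCM/PerLWeilLineClassesAnyRealisation.lean`):
* `isFrame_frameOfModel` — the frame `φ' = (e⁻¹(2,+), e⁻¹(0,+), e⁻¹(1,+))` is a frame (`IsFrame`);
* `isPerLTypes_frameOfModel` — `t' = (Φ₄ 0, Φ̄₄ 3, Φ₄ 1, Φ₄ 2)` is a PerL quadruple for `φ'` (sign table `perlSign`),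
  whose CORNER quadruple `(t'⁰, t̄'², t̄'³, t'¹)` is `(Φ₄ 0, Φ̄₄ 1, Φ̄₄ 2, Φ̄₄ 3)` — realised by `A₄` ITSELF with the
  `𝓞_K`-actions twisted by complex conjugation at slots `1, 2, 3` (`Model.isCMTypeRealisation_bar_comp_complexConj`);
* `weightClassesAlg_face_le_weilLineClasses_twist` — the weight line of a face weight of `Y` (untwisted actions) lies in
  the `K`-Weil-line space of `Y` with the twisted actions (the twist conjugates the embeddings at slots `1, 2, 3`);
* **`hface_of_perL`** — hence `PerL(U)` ⟹ `hface`;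
* `hface_of_periodNV`, **`hodgeConjectureFor_biproduct_comp_of_periodNV_rec`**, `…_of_avDominatedBy_of_periodNV_rec` —
  the FIELD-LOCAL form: ONE non-vanishing Picard-modular period for the quadruple `(Φ₄ 0, Φ̄₄ 3, Φ₄ 1, Φ₄ 2)` (any surface
  field, `ι₁`, `V`, `σ`) already gives `hface` and hence HC for all the powers — no `PerL`, no frame/sign-table input;
* **`hodgeConjectureFor_biproduct_comp_of_perL_rec`**, **`hodgeConjectureFor_of_avDominatedBy_of_perL_rec`** —
  `PerL(U_rec)` ⟹ `HodgeConjectureFor (⨁_j A₄ (κ j))` for every `κ`, and for every abelian variety dominated by such a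
  product (every abelian variety isogenous to a product of powers of `X₀, …, X₃`).

The intrinsic form (frame `e`, `he_conj`, `he_gal` from `[L:ℚ] ∈ {24, 48}`, p2 `CorCM/SexticCMFieldPairFlip.lean`) is
b25's announced sequel; here the frame data are hypotheses, exactly as in the transfer theorem.
References: PerL v5 Thm 4.4; rfwf v3 Prop 2.2 / §4.2; Pohlmann 1968 Thm 1; Gao–Ullmo 2025 Thm 3.1; Milne 2020 Thm 1;
`hodge-director/B01-SIZE.md` §4 T2 (W-a + W-b).
-/

noncomputable section

open CategoryTheory CategoryTheory.Limits NumberField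
open Literature.AlgebraicGeometry Literature.AlgebraicGeometry.Motives Literature.AlgebraicGeometry.HodgeTheory
open Literature.AlgebraicGeometry.ComplexMultiplication (IsCMTypeRealisation)
open Literature.AlgebraicGeometry.Pohlmann1968
open Literature.NumberTheory.Automorphic
open Literature.NumberTheory.Automorphic.PicardCM (BallQuotientUniformisedDatum CMAbelianVarietyRealised)
open Literature.NumberTheory.ComplexMultiplication.CMTypeOps (bar mem_bar_iff)
open NumberField.ComplexEmbedding (conjugate conjugate_coe_eq)
open Summit.HodgeConjecture.CorCM.Census.PairFlipSexticFourCore (Pt phi face flipAt)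
open Summit.HodgeConjecture.CorCM.PairFlipSexticFourCore (toPt toPt_mk toPt_injective
  hodgeConjectureFor_biproduct_comp_of_faces)
open scoped Classical

namespace Summit.HodgeConjecture.CorCM.PerLFourCore

/-! ## §1 The frame and the PerL quadruple read off the model frame `e` -/

section Frame

variable {K : CMField} {e : ((K : Type) →+* ℂ) ≃ ZMod 3 × Bool}

/-- A model frame with conjugation flipping the sign has `6` embeddings: `[K:ℚ] = 6`. [folklore] -/
theorem finrank_eq_six (e : ((K : Type) →+* ℂ) ≃ ZMod 3 × Bool) : Module.finrank ℚ K = 6 := by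
  rw [← Embeddings.card (K : Type) ℂ, Fintype.card_congr e]
  rfl

/-- In a model frame with `he_conj`, two embeddings have the same place-coordinate iff they are equal or conjugate.
[folklore] -/
theorem eq_or_eq_conjugate_of_fst_eq
    (he_conj : ∀ s : (K : Type) →+* ℂ, e (conjugate s) = ((e s).1, !(e s).2)) {s s' : (K : Type) →+* ℂ}
    (h : (e s').1 = (e s).1) : s' = s ∨ s' = conjugate s := by
  by_cases h2 : (e s').2 = (e s).2
  · left
    exact e.injective (Prod.ext h h2)
  · right
    apply e.injective
    rw [he_conj, Prod.ext_iff]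
    exact ⟨h, by cases hs : (e s).2 <;> cases hs' : (e s').2 <;> simp_all⟩

/-- **The frame of the model**: `φ' k = e⁻¹ (p k, +)` with places `p = (2, 0, 1)` is a frame. [folklore] -/
theorem isFrame_frameOfModel
    (he_conj : ∀ s : (K : Type) →+* ℂ, e (conjugate s) = ((e s).1, !(e s).2)) :
    IsFrame (fun k : Fin 3 => e.symm (((![2, 0, 1] : Fin 3 → ZMod 3) k), true)) := by
  intro j j' hne heq
  have hp : Function.Injective (![2, 0, 1] : Fin 3 → ZMod 3) := by decide
  rcases InfinitePlace.mk_eq_iff.1 heq with h | h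
  · exact hne (hp (by simpa using congrArg (fun s => (e s).1) h))
  · have h2 := congrArg (fun s => (e s).2) h
    simp only [he_conj, Equiv.apply_symm_apply] at h2
    exact Bool.noConfusion h2

variable {Φ₄ : Fin 4 → CMType (K : Type)}

/-- Membership of the frame embeddings in the four types, read in the model. [folklore] -/
theorem frame_mem_iff (hΦ : ∀ (b : Fin 4) (s : (K : Type) →+* ℂ), s ∈ (Φ₄ b).1 ↔ ((b, (e s).1, (e s).2) : Pt) ∈ phi)
    (b : Fin 4) (k : Fin 3) :
    e.symm (((![2, 0, 1] : Fin 3 → ZMod 3) k), true) ∈ (Φ₄ b).1 ↔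
      ((b, (![2, 0, 1] : Fin 3 → ZMod 3) k, true) : Pt) ∈ phi := by
  rw [hΦ, Equiv.apply_symm_apply]

/-- **The PerL quadruple of the model**: `t' = (Φ₄ 0, Φ̄₄ 3, Φ₄ 1, Φ₄ 2)` has the sign table `perlSign` for the frame
`φ'` (`Φ₄ 0 = (+,+,+)`, `Φ₄ b` negative exactly at place `b − 1`; places of the frame `2, 0, 1`). [folklore] -/
theorem isPerLTypes_frameOfModel
    (hΦ : ∀ (b : Fin 4) (s : (K : Type) →+* ℂ), s ∈ (Φ₄ b).1 ↔ ((b, (e s).1, (e s).2) : Pt) ∈ phi) :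
    IsPerLTypes (fun k : Fin 3 => e.symm (((![2, 0, 1] : Fin 3 → ZMod 3) k), true))
      ![Φ₄ 0, bar (Φ₄ 3), Φ₄ 1, Φ₄ 2] := by
  have hm := frame_mem_iff hΦ
  intro k j
  fin_cases k <;> fin_cases j
  · exact (hm 0 0).trans (by decide)
  · exact (hm 0 1).trans (by decide)
  · exact (hm 0 2).trans (by decide)
  · exact (not_congr (hm 3 0)).trans (by decide)
  · exact (not_congr (hm 3 1)).trans (by decide)
  · exact (not_congr (hm 3 2)).trans (by decide)
  · exact (hm 1 0).trans (by decide)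
  · exact (hm 1 1).trans (by decide)
  · exact (hm 1 2).trans (by decide)
  · exact (hm 2 0).trans (by decide)
  · exact (hm 2 1).trans (by decide)
  · exact (hm 2 2).trans (by decide)

end Frame

/-! ## §2 The face weight lines of `Y` lie in the `K`-Weil-line space of the twisted family -/

section Twist

variable {K : CMField} {A₄ : Fin 4 → AbelianVariety ℂ} (ι₄ : ∀ b : Fin 4, 𝓞 (K : Type) →+* End (A₄ b))

/-- The face weight `{(0,s), (1,s̄), (2,s̄), (3,s̄)}` of `Y = ⨁ A₄` read back from the model. [folklore] -/
theorem eq_face_finset {e : ((K : Type) →+* ℂ) ≃ ZMod 3 × Bool}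
    (he_conj : ∀ s : (K : Type) →+* ℂ, e (conjugate s) = ((e s).1, !(e s).2)) {i : ZMod 3} {sg : Bool}
    {T : Finset ((_ : Fin 4) × ((K : Type) →+* ℂ))} (hT : T.image (toPt e) = face i sg) :
    T = ({(⟨0, e.symm (i, sg)⟩ : (_ : Fin 4) × ((K : Type) →+* ℂ)), (⟨1, conjugate (e.symm (i, sg))⟩ : (_ : Fin 4) × ((K : Type) →+* ℂ)),
      (⟨2, conjugate (e.symm (i, sg))⟩ : (_ : Fin 4) × ((K : Type) →+* ℂ)), (⟨3, conjugate (e.symm (i, sg))⟩ : (_ : Fin 4) × ((K : Type) →+* ℂ))} : Finset ((_ : Fin 4) × ((K : Type) →+* ℂ))) := by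
  apply Finset.image_injective (toPt_injective e)
  rw [hT]
  simp only [Finset.image_insert, Finset.image_singleton, toPt_mk, he_conj, Equiv.apply_symm_apply]
  rfl

/-- **A face weight line of `Y` (untwisted actions) lies in the `K`-Weil-line space of `Y` with the actions twisted
by complex conjugation at slots `1, 2, 3`**: on `c` in the weight line of `{(0,s), (1,s̄), (2,s̄), (3,s̄)}`, the
twisted diagonal action of `a ∈ 𝓞_K` is the untwisted action of `(a, ā, ā, ā)`, with eigenvalue
`s(a) s̄(ā) s̄(ā) s̄(ā) = s(a)⁴`. [cite: Milne2020HodgeClassesAV, Theorem 1 (proof)] -/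
theorem weightClassesAlg_face_le_weilLineClasses_twist (s : (K : Type) →+* ℂ) :
    weightClassesAlg (K := fun _ : Fin 4 => (K : Type)) A₄ ι₄ (2 * 2)
        ({(⟨0, s⟩ : (_ : Fin 4) × ((K : Type) →+* ℂ)), (⟨1, conjugate s⟩ : (_ : Fin 4) × ((K : Type) →+* ℂ)), (⟨2, conjugate s⟩ : (_ : Fin 4) × ((K : Type) →+* ℂ)), (⟨3, conjugate s⟩ : (_ : Fin 4) × ((K : Type) →+* ℂ))} :
          Finset ((_ : Fin 4) × ((K : Type) →+* ℂ))) ≤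
      weilLineClasses A₄ (fun b : Fin 4 => match b with
        | 0 => ι₄ 0
        | 1 => (ι₄ 1).comp (RingOfIntegers.mapRingHom (IsCMField.complexConj (K : Type)).toRingEquiv.toRingHom)
        | 2 => (ι₄ 2).comp (RingOfIntegers.mapRingHom (IsCMField.complexConj (K : Type)).toRingEquiv.toRingHom)
        | 3 => (ι₄ 3).comp (RingOfIntegers.mapRingHom (IsCMField.complexConj (K : Type)).toRingEquiv.toRingHom))
        4 := by
  intro c hc
  refine Submodule.mem_iSup_of_mem s ((Submodule.mem_iInf _).2 fun a => ?_)
  rw [Module.End.mem_eigenspace_iff, diagonalAction_def]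
  -- the twisted tuple `(a, ā, ā, ā)`
  let a' : Fin 4 → 𝓞 (K : Type) := fun b => match b with
    | 0 => a
    | 1 => RingOfIntegers.mapRingHom (IsCMField.complexConj (K : Type)).toRingEquiv.toRingHom a
    | 2 => RingOfIntegers.mapRingHom (IsCMField.complexConj (K : Type)).toRingEquiv.toRingHom a
    | 3 => RingOfIntegers.mapRingHom (IsCMField.complexConj (K : Type)).toRingEquiv.toRingHom a
  have hfun : (fun b : Fin 4 => ((match b with
        | 0 => ι₄ 0
        | 1 => (ι₄ 1).comp (RingOfIntegers.mapRingHom (IsCMField.complexConj (K : Type)).toRingEquiv.toRingHom)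
        | 2 => (ι₄ 2).comp (RingOfIntegers.mapRingHom (IsCMField.complexConj (K : Type)).toRingEquiv.toRingHom)
        | 3 => (ι₄ 3).comp (RingOfIntegers.mapRingHom (IsCMField.complexConj (K : Type)).toRingEquiv.toRingHom)
          : 𝓞 (K : Type) →+* End (A₄ b)) a : A₄ b ⟶ A₄ b)) = fun b => (ι₄ b (a' b) : A₄ b ⟶ A₄ b) := by
    funext b
    match b with
    | 0 => rfl
    | 1 => rfl
    | 2 => rfl
    | 3 => rfl
  rw [hfun]
  have h := (mem_weightClassesAlg_iff.1 hc) a'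
  -- the scalar: `s(a) · s̄(ā)³ = s(a)⁴`
  have hbar : conjugate s ((RingOfIntegers.mapRingHom (IsCMField.complexConj (K : Type)).toRingEquiv.toRingHom a :
      𝓞 (K : Type)) : (K : Type)) = s a := by
    rw [conjugate_coe_eq, RingOfIntegers.mapRingHom_apply]
    change (starRingEnd ℂ) (s (IsCMField.complexConj (K : Type) (a : (K : Type)))) = s a
    rw [IsCMField.complexEmbedding_complexConj, starRingEnd_self_apply]
  have hprod : (∏ x ∈ ({(⟨0, s⟩ : (_ : Fin 4) × ((K : Type) →+* ℂ)), (⟨1, conjugate s⟩ : (_ : Fin 4) × ((K : Type) →+* ℂ)), (⟨2, conjugate s⟩ : (_ : Fin 4) × ((K : Type) →+* ℂ)),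
      (⟨3, conjugate s⟩ : (_ : Fin 4) × ((K : Type) →+* ℂ))} : Finset ((_ : Fin 4) × ((K : Type) →+* ℂ))), x.2 ((a' x.1 : 𝓞 (K : Type)) : (K : Type))) = (s a) ^ 4 := by
    rw [Finset.prod_insert (by simp), Finset.prod_insert (by simp), Finset.prod_insert (by simp),
      Finset.prod_singleton]
    change s a * (conjugate s _ * (conjugate s _ * conjugate s _)) = _
    rw [hbar]
    ring
  rw [hprod] at h
  exact h

end Twist

/-! ## §3 `hface` from `PerL` (or from ONE period), and the Hodge conjecture for the powers -/

section Glue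

variable {K : CMField} {e : ((K : Type) →+* ℂ) ≃ ZMod 3 × Bool} {A₄ : Fin 4 → AbelianVariety ℂ}
  {Φ₄ : Fin 4 → CMType (K : Type)} {ι₄ : ∀ b : Fin 4, 𝓞 (K : Type) →+* End (A₄ b)}
  {θ₄ : ∀ b : Fin 4, (K : Type) →+* Module.End ℂ (complexBetti (A₄ b).X 1)}
  (hA : ∀ b, IsCMTypeRealisation (Φ₄ b) (A₄ b) (ι₄ b) (θ₄ b))
  (he_conj : ∀ s : (K : Type) →+* ℂ, e (conjugate s) = ((e s).1, !(e s).2))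
  (he_gal : ∀ (j : ZMod 3) (fl : Bool × Bool × Bool), ∃ σ : ℂ ≃+* ℂ, ∀ s : (K : Type) →+* ℂ,
    e ((σ : ℂ →+* ℂ).comp s) = ((e s).1 + j, xor (e s).2 (flipAt fl ((e s).1 + j))))
  (hΦ : ∀ (b : Fin 4) (s : (K : Type) →+* ℂ), s ∈ (Φ₄ b).1 ↔ ((b, (e s).1, (e s).2) : Pt) ∈ phi)

include hA in
/-- The realisations `A₄`, with the `𝓞_K`-actions twisted by complex conjugation at slots `1, 2, 3`, realise the corner
quadruple `(Φ₄ 0, Φ̄₄ 1, Φ̄₄ 2, Φ̄₄ 3)` of the model quadruple `(Φ₄ 0, Φ̄₄ 3, Φ₄ 1, Φ₄ 2)`.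
[cite: Deligne1982HodgeCycles, §5 (b) (TeXed re-edition p. 38)] -/
theorem isCMTypeRealisation_corner_twist (b : Fin 4) :
    IsCMTypeRealisation
      ((![(![Φ₄ 0, bar (Φ₄ 3), Φ₄ 1, Φ₄ 2] : Fin 4 → CMType (K : Type)) 0,
          bar ((![Φ₄ 0, bar (Φ₄ 3), Φ₄ 1, Φ₄ 2] : Fin 4 → CMType (K : Type)) 2),
          bar ((![Φ₄ 0, bar (Φ₄ 3), Φ₄ 1, Φ₄ 2] : Fin 4 → CMType (K : Type)) 3),
          (![Φ₄ 0, bar (Φ₄ 3), Φ₄ 1, Φ₄ 2] : Fin 4 → CMType (K : Type)) 1] : Fin 4 → CMType (K : Type)) b)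
      (A₄ b)
      ((fun b : Fin 4 => (match b with
        | 0 => ι₄ 0
        | 1 => (ι₄ 1).comp (RingOfIntegers.mapRingHom (IsCMField.complexConj (K : Type)).toRingEquiv.toRingHom)
        | 2 => (ι₄ 2).comp (RingOfIntegers.mapRingHom (IsCMField.complexConj (K : Type)).toRingEquiv.toRingHom)
        | 3 => (ι₄ 3).comp (RingOfIntegers.mapRingHom (IsCMField.complexConj (K : Type)).toRingEquiv.toRingHom)
          : 𝓞 (K : Type) →+* End (A₄ b))) b)
      ((fun b : Fin 4 => (match b with
        | 0 => θ₄ 0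
        | 1 => (θ₄ 1).comp (IsCMField.complexConj (K : Type)).toRingEquiv.toRingHom
        | 2 => (θ₄ 2).comp (IsCMField.complexConj (K : Type)).toRingEquiv.toRingHom
        | 3 => (θ₄ 3).comp (IsCMField.complexConj (K : Type)).toRingEquiv.toRingHom
          : (K : Type) →+* Module.End ℂ (complexBetti (A₄ b).X 1))) b) := by
  match b with
  | 0 => exact hA 0
  | 1 => exact Model.isCMTypeRealisation_bar_comp_complexConj (hA 1)
  | 2 => exact Model.isCMTypeRealisation_bar_comp_complexConj (hA 2)
  | 3 => exact Model.isCMTypeRealisation_bar_comp_complexConj (hA 3)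

include hA he_conj hΦ in
/-- **`PerL(U)` discharges the face hypothesis `hface` of the transfer theorem.**  For a pair-flip sextic CM field in
a model frame, realisations `A₄ b ⊨ (K; Φ₄ b)` and ANY normal closure `j : K → L` of degree `24` or `48`: if `U.PerL`
holds on the model universe `U = Model.universeOf hHD hI hU h₃`, every face weight line of `Y = ⨁ A₄` is algebraic —
`PerL` at the frame `φ'`, the quadruple `t'` and some `ι₁ : L → ℂ` over `φ' 0`; the corner family is `A₄` twisted at
slots `1, 2, 3`; `Model.weilLineClasses_le_algebraicClasses_of_perL_of_isCMTypeRealisation` + §2.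
[cite: Milne2020HodgeClassesAV, Theorem 1 (proof)] -/
theorem hface_of_perL (hHD : exists_isReal_hodgeModel) (hI : hodgePQ_independent_of_hodgeModel)
    (hU : BallQuotientUniformisedDatum) (h₃ : CMAbelianVarietyRealised) (hP : (Model.universeOf hHD hI hU h₃).PerL)
    (L : CMField) (j : (K : Type) →+* (L : Type)) (hN : IsNormalClosure ℚ (K : Type) (L : Type))
    (hL : Module.finrank ℚ L = 24 ∨ Module.finrank ℚ L = 48) :
    ∀ (i : ZMod 3) (sg : Bool) (T : Finset ((_ : Fin 4) × ((K : Type) →+* ℂ))), T.image (toPt e) = face i sg →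
      weightClassesAlg (K := fun _ : Fin 4 => (K : Type)) A₄ ι₄ (2 * 2) T ≤ algebraicClasses (⨁ A₄).X 2 := by
  intro i sg T hT
  obtain ⟨ι₁, hι⟩ := PerLTypes.exists_ringHom_comp_eq K L j (e.symm (((![2, 0, 1] : Fin 3 → ZMod 3) 0), true))
  have hWL := Model.weilLineClasses_le_algebraicClasses_of_perL_of_isCMTypeRealisation hHD hI hU h₃ hP K L j hN
    (finrank_eq_six e) hL _ (isFrame_frameOfModel he_conj) ι₁ hι _ (isPerLTypes_frameOfModel hΦ)
    (isCMTypeRealisation_corner_twist hA)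
  rw [eq_face_finset he_conj hT]
  exact (weightClassesAlg_face_le_weilLineClasses_twist ι₄ (e.symm (i, sg))).trans hWL

include hA he_conj in
/-- **ONE period ⟹ `hface`** (field-local form; no `PerL`, no frame / sign table): a single non-vanishing quadrilinear
Picard-modular period on `U = Model.universeOf hHD hI hU h₃` for the quadruple `(Φ₄ 0, Φ̄₄ 3, Φ₄ 1, Φ₄ 2)` — over ANY
surface field `L`, `ι₁`, hermitian `V`, eigencharacter `σ` — makes the six face weight lines of `Y = ⨁ A₄` algebraic
(`Model.weilLineClasses_le_algebraicClasses_of_periodNV_of_isCMTypeRealisation` + §2; the «INT-2», Δ5-shape arrow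
for the pair-flip sextic field class). [cite: Milne2020HodgeClassesAV, Theorem 1 (proof)] -/
theorem hface_of_periodNV (hHD : exists_isReal_hodgeModel) (hI : hodgePQ_independent_of_hodgeModel)
    (hU : BallQuotientUniformisedDatum) (h₃ : CMAbelianVarietyRealised)
    (h : ∃ (L : CMField) (ι₁ : L →+* ℂ) (V : HermSpace3 L ι₁) (σ : (K : Type) →+* ℂ),
      (Model.universeOf hHD hI hU h₃).PeriodNV ι₁ V K ![Φ₄ 0, bar (Φ₄ 3), Φ₄ 1, Φ₄ 2] σ) :
    ∀ (i : ZMod 3) (sg : Bool) (T : Finset ((_ : Fin 4) × ((K : Type) →+* ℂ))), T.image (toPt e) = face i sg →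
      weightClassesAlg (K := fun _ : Fin 4 => (K : Type)) A₄ ι₄ (2 * 2) T ≤ algebraicClasses (⨁ A₄).X 2 := by
  intro i sg T hT
  obtain ⟨L, ι₁, V, σ, hV⟩ := h
  have hWL := Model.weilLineClasses_le_algebraicClasses_of_periodNV_of_isCMTypeRealisation hHD hI hU h₃ hV
    (isCMTypeRealisation_corner_twist hA)
  rw [eq_face_finset he_conj hT]
  exact (weightClassesAlg_face_le_weilLineClasses_twist ι₄ (e.symm (i, sg))).trans hWL

include hA he_conj he_gal hΦ in
/-- **`PerL(U)` ⟹ the Hodge conjecture for EVERY product of powers `⨁_j A₄ (κ j)` of the four CM threefolds of a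
pair-flip sextic CM field (frame form)** — b25's transfer theorem with its single Hodge-theoretic hypothesis `hface`
discharged by `PerL`.  NOT HC_CM: a named class, conditional on stage 1's statement.
[cite: Pohlmann1968, Thm 1] [cite: GaoUllmo2025, Thm 3.1] [cite: Milne2020HodgeClassesAV, Theorem 1 (proof)] -/
theorem hodgeConjectureFor_biproduct_comp_of_perL (hHD : exists_isReal_hodgeModel)
    (hI : hodgePQ_independent_of_hodgeModel) (hU : BallQuotientUniformisedDatum) (h₃ : CMAbelianVarietyRealised)
    (hP : (Model.universeOf hHD hI hU h₃).PerL) (L : CMField) (j : (K : Type) →+* (L : Type))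
    (hN : IsNormalClosure ℚ (K : Type) (L : Type)) (hL : Module.finrank ℚ L = 24 ∨ Module.finrank ℚ L = 48)
    {N : ℕ} (κ : Fin N → Fin 4) :
    HodgeConjectureFor (⨁ fun j => A₄ (κ j)).dim (⨁ fun j => A₄ (κ j)).X :=
  hodgeConjectureFor_biproduct_comp_of_faces κ hA he_conj he_gal hΦ
    (hface_of_perL hA he_conj hΦ hHD hI hU h₃ hP L j hN hL)

include hA he_conj he_gal hΦ in
/-- **`PerL(U_rec)` ⟹ the Hodge conjecture for every product of powers of the four CM threefolds** (model universe
of record; single hypothesis `U_rec.PerL` beyond the frame data). NOT HC_CM. [cite: Pohlmann1968, Thm 1]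
[cite: Milne2020HodgeClassesAV, Theorem 1 (proof)] -/
theorem hodgeConjectureFor_biproduct_comp_of_perL_rec
    (hP : (Model.picardCMUniverse exists_isReal_hodgeModel_holds hodgePQ_independent_of_hodgeModel_holds
      BallQuotient.ballQuotientUniformised_holds cmAbelianVarietyRealised_holds).PerL)
    (L : CMField) (j : (K : Type) →+* (L : Type)) (hN : IsNormalClosure ℚ (K : Type) (L : Type))
    (hL : Module.finrank ℚ L = 24 ∨ Module.finrank ℚ L = 48) {N : ℕ} (κ : Fin N → Fin 4) :
    HodgeConjectureFor (⨁ fun j => A₄ (κ j)).dim (⨁ fun j => A₄ (κ j)).X :=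
  hodgeConjectureFor_biproduct_comp_of_perL hA he_conj he_gal hΦ exists_isReal_hodgeModel_holds
    hodgePQ_independent_of_hodgeModel_holds
    (PicardCM.ballQuotientUniformisedDatum_of BallQuotient.ballQuotientUniformised_holds) cmAbelianVarietyRealised_holds
    hP L j hN hL κ

include hA he_conj he_gal hΦ in
/-- **`PerL(U_rec)` ⟹ the Hodge conjecture for every abelian variety DOMINATED BY a product of powers of the four CM
threefolds** — every abelian variety isogenous to a product of powers of `X₀, …, X₃`, their abelian subvarieties and
quotients (frame form). NOT HC_CM. [cite: Milne2020HodgeClassesAV, Theorem 1] [cite: MumfordAV1970, §19] -/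
theorem hodgeConjectureFor_of_avDominatedBy_of_perL_rec
    (hP : (Model.picardCMUniverse exists_isReal_hodgeModel_holds hodgePQ_independent_of_hodgeModel_holds
      BallQuotient.ballQuotientUniformised_holds cmAbelianVarietyRealised_holds).PerL)
    (L : CMField) (j : (K : Type) →+* (L : Type)) (hN : IsNormalClosure ℚ (K : Type) (L : Type))
    (hL : Module.finrank ℚ L = 24 ∨ Module.finrank ℚ L = 48) {N : ℕ} (κ : Fin N → Fin 4)
    {B : AbelianVariety ℂ} (hB : Domination.AVDominatedBy B (⨁ fun j => A₄ (κ j))) :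
    HodgeConjectureFor B.dim B.X :=
  Domination.hodgeConjectureFor_of_avDominatedBy
    (hodgeConjectureFor_biproduct_comp_of_perL_rec hA he_conj he_gal hΦ hP L j hN hL κ) hB

include hA he_conj he_gal hΦ in
/-- **ONE period ⟹ the Hodge conjecture for every product of powers of the four CM threefolds** (model universe of
record): if SOME Picard modular surface carries a non-vanishing quadrilinear period for the quadruple
`(Φ₄ 0, Φ̄₄ 3, Φ₄ 1, Φ₄ 2)`, then `HodgeConjectureFor (⨁_j A₄ (κ j))` for every `κ` — the field-local form of the
W-a + W-b arrow (one period datum for the field, no universal statement).  NOT HC_CM.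
[cite: Pohlmann1968, Thm 1] [cite: GaoUllmo2025, Thm 3.1] [cite: Milne2020HodgeClassesAV, Theorem 1 (proof)] -/
theorem hodgeConjectureFor_biproduct_comp_of_periodNV_rec
    (h : ∃ (L : CMField) (ι₁ : L →+* ℂ) (V : HermSpace3 L ι₁) (σ : (K : Type) →+* ℂ),
      (Model.picardCMUniverse exists_isReal_hodgeModel_holds hodgePQ_independent_of_hodgeModel_holds
        BallQuotient.ballQuotientUniformised_holds cmAbelianVarietyRealised_holds).PeriodNV ι₁ V K
        ![Φ₄ 0, bar (Φ₄ 3), Φ₄ 1, Φ₄ 2] σ)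
    {N : ℕ} (κ : Fin N → Fin 4) :
    HodgeConjectureFor (⨁ fun j => A₄ (κ j)).dim (⨁ fun j => A₄ (κ j)).X :=
  hodgeConjectureFor_biproduct_comp_of_faces κ hA he_conj he_gal hΦ
    (hface_of_periodNV hA he_conj exists_isReal_hodgeModel_holds hodgePQ_independent_of_hodgeModel_holds
      (PicardCM.ballQuotientUniformisedDatum_of BallQuotient.ballQuotientUniformised_holds) cmAbelianVarietyRealised_holds
      h)

include hA he_conj he_gal hΦ in
/-- **ONE period ⟹ the Hodge conjecture for every abelian variety dominated by a product of powers of the four CM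
threefolds** (model universe of record). NOT HC_CM. [cite: Milne2020HodgeClassesAV, Theorem 1] [cite: MumfordAV1970, §19] -/
theorem hodgeConjectureFor_of_avDominatedBy_of_periodNV_rec
    (h : ∃ (L : CMField) (ι₁ : L →+* ℂ) (V : HermSpace3 L ι₁) (σ : (K : Type) →+* ℂ),
      (Model.picardCMUniverse exists_isReal_hodgeModel_holds hodgePQ_independent_of_hodgeModel_holds
        BallQuotient.ballQuotientUniformised_holds cmAbelianVarietyRealised_holds).PeriodNV ι₁ V K
        ![Φ₄ 0, bar (Φ₄ 3), Φ₄ 1, Φ₄ 2] σ)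
    {N : ℕ} (κ : Fin N → Fin 4) {B : AbelianVariety ℂ} (hB : Domination.AVDominatedBy B (⨁ fun j => A₄ (κ j))) :
    HodgeConjectureFor B.dim B.X :=
  Domination.hodgeConjectureFor_of_avDominatedBy
    (hodgeConjectureFor_biproduct_comp_of_periodNV_rec hA he_conj he_gal hΦ h κ) hB

end Glue

end Summit.HodgeConjecture.CorCM.PerLFourCore

end
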